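import Literature.NumberTheory.EllipticCurves.PAdicMeasureLattice
import HarnessLib

/-!
# `𝔻⁰` is complete for the congruence filtration: `𝔻⁰ ≅ lim 𝔻⁰ / K_N`

For the lattice `𝔻⁰(T)` of `ℤ_p`-valued bounded distributions on a profinite tower `T` and its
congruence submodules `K_N` (`PAdicMeasureLattice`: `⋂ K_N = 0`, `𝔻⁰/K_N` finite) we prove the
SURJECTIVITY of `𝔻⁰ → lim_N 𝔻⁰/K_N`: every sequence `(μ^{(N)})_N` in `𝔻⁰` which is compatible modulo
the `K_N` (`μ^{(N')} − μ^{(N)} ∈ K_N` for `N ≤ N'`) has a limit `ν ∈ 𝔻⁰` with `ν − μ^{(N)} ∈ K_N` for all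
`N` (`exists_limit_of_compatible`).  The level data of `ν` are the `p`-adic limits of those of the
`μ^{(N)}` (Cauchy by `norm_le_of_mem_congrSub`).  Together with `eq_zero_of_forall_mem_congrSub`
this is `𝔻⁰ ≅ lim 𝔻⁰/K_N`, the profinite structure on which Hida's ordinary projector is assembled
from the finite levels (Greenberg–Stevens 1993, §1).

Brick B2m-a of the bottom-up plan recorded with the named fact
`greenbergStevens_kitagawa_twoVariable_interpolation_allBranches`.  Everything is proved; no named facts.

## References

* R. Greenberg, G. Stevens, Invent. Math. 111 (1993), §1. [GreenbergStevens1993]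
-/

noncomputable section

open Filter Topology

namespace Literature.NumberTheory.EllipticCurves

namespace ProfiniteTower

variable {p : ℕ} [Fact p.Prime] {X : Type*} [PseudoMetricSpace X] (T : ProfiniteTower X)

/-- Level data of a compatible sequence form Cauchy sequences: for `m ≤ N ≤ N'`,
`‖μ^{(N')}_m(a) − μ^{(N)}_m(a)‖ ≤ p^{-N}`. [folklore] -/
theorem norm_sub_le_of_compatible {μs : ℕ → (n : ℕ) → T.Cell n → ℚ_[p]}
    (hcompat : ∀ N N' : ℕ, N ≤ N' → μs N' - μs N ∈ T.congrSub p N) {m N N' : ℕ} (hm : m ≤ N) (hN : N ≤ N')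
    (a : T.Cell m) : ‖μs N' m a - μs N m a‖ ≤ (p : ℝ) ^ (-(N : ℤ)) := by
  have h := T.norm_le_of_mem_congrSub (hcompat N N' hN) hm a
  rwa [Pi.sub_apply, Pi.sub_apply] at h

/-- The level data of a compatible sequence are Cauchy. [folklore] -/
theorem cauchySeq_of_compatible {μs : ℕ → (n : ℕ) → T.Cell n → ℚ_[p]}
    (hcompat : ∀ N N' : ℕ, N ≤ N' → μs N' - μs N ∈ T.congrSub p N) (m : ℕ) (a : T.Cell m) :
    CauchySeq fun N => μs N m a := by
  have hp1 : (1 : ℝ) < p := by exact_mod_cast (Fact.out : p.Prime).one_lt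
  refine Metric.cauchySeq_iff'.mpr fun ε hε => ?_
  obtain ⟨N₀, hN₀⟩ := exists_pow_lt_of_lt_one hε (inv_lt_one_of_one_lt₀ hp1)
  refine ⟨max m N₀, fun n hn => ?_⟩
  rw [dist_eq_norm]
  calc ‖μs n m a - μs (max m N₀) m a‖ ≤ (p : ℝ) ^ (-((max m N₀ : ℕ) : ℤ)) :=
        T.norm_sub_le_of_compatible hcompat (le_max_left m N₀) hn a
    _ ≤ (p : ℝ) ^ (-(N₀ : ℤ)) := zpow_le_zpow_right₀ hp1.le (by simp)
    _ = ((p : ℝ)⁻¹) ^ N₀ := by rw [zpow_neg, zpow_natCast, inv_pow]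
    _ < ε := hN₀

/-- **The limit of a compatible sequence**: its level data. [folklore] -/
def limitFn (μs : ℕ → (n : ℕ) → T.Cell n → ℚ_[p]) : (n : ℕ) → T.Cell n → ℚ_[p] :=
  fun m a => limUnder atTop fun N => μs N m a

/-- The level data of the limit are limits. [folklore] -/
theorem tendsto_limitFn {μs : ℕ → (n : ℕ) → T.Cell n → ℚ_[p]}
    (hcompat : ∀ N N' : ℕ, N ≤ N' → μs N' - μs N ∈ T.congrSub p N) (m : ℕ) (a : T.Cell m) :
    Tendsto (fun N => μs N m a) atTop (𝓝 (T.limitFn μs m a)) :=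
  (cauchySeq_tendsto_of_complete (T.cauchySeq_of_compatible hcompat m a)).choose_spec |> fun h => by
    rw [limitFn]
    exact tendsto_nhds_limUnder ⟨_, h⟩

/-- **The limit lies in `𝔻⁰`.** [folklore] -/
theorem limitFn_mem {μs : ℕ → (n : ℕ) → T.Cell n → ℚ_[p]} (hμs : ∀ N, μs N ∈ T.distributionsInt p)
    (hcompat : ∀ N N' : ℕ, N ≤ N' → μs N' - μs N ∈ T.congrSub p N) :
    T.limitFn μs ∈ T.distributionsInt p := by
  refine ⟨⟨fun m a => ?_, 1, fun m a => ?_⟩, fun m a => ?_⟩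
  · -- additivity passes to the limit
    have h1 : Tendsto (fun N => ∑ b ∈ Finset.univ.filter (fun b : T.Cell (m + 1) => T.trans m b = a), μs N (m + 1) b)
        atTop (𝓝 (∑ b ∈ Finset.univ.filter (fun b : T.Cell (m + 1) => T.trans m b = a), T.limitFn μs (m + 1) b)) :=
      tendsto_finsetSum _ fun b _ => T.tendsto_limitFn hcompat (m + 1) b
    have h2 : (fun N => ∑ b ∈ Finset.univ.filter (fun b : T.Cell (m + 1) => T.trans m b = a), μs N (m + 1) b) =
        fun N => μs N m a := funext fun N => (hμs N).1.1 m a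
    rw [h2] at h1
    exact tendsto_nhds_unique h1 (T.tendsto_limitFn hcompat m a)
  · exact le_of_tendsto (T.tendsto_limitFn hcompat m a).norm (Eventually.of_forall fun N => (hμs N).2 m a)
  · exact le_of_tendsto (T.tendsto_limitFn hcompat m a).norm (Eventually.of_forall fun N => (hμs N).2 m a)

/-- **The limit is congruent to `μ^{(N)}` modulo `K_N`.** [folklore] -/
theorem limitFn_sub_mem_congrSub {μs : ℕ → (n : ℕ) → T.Cell n → ℚ_[p]} (hμs : ∀ N, μs N ∈ T.distributionsInt p)
    (hcompat : ∀ N N' : ℕ, N ≤ N' → μs N' - μs N ∈ T.congrSub p N) (N : ℕ) :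
    T.limitFn μs - μs N ∈ T.congrSub p N := by
  refine ⟨sub_mem (T.limitFn_mem hμs hcompat) (hμs N), fun a => ?_⟩
  rw [Pi.sub_apply, Pi.sub_apply]
  have h : Tendsto (fun N' => μs N' N a - μs N N a) atTop (𝓝 (T.limitFn μs N a - μs N N a)) :=
    (T.tendsto_limitFn hcompat N a).sub tendsto_const_nhds
  refine le_of_tendsto h.norm ?_
  filter_upwards [eventually_ge_atTop N] with N' hN'
  exact T.norm_sub_le_of_compatible hcompat le_rfl hN' a

/-- **`𝔻⁰` is `K`-adically complete** (`𝔻⁰ → lim 𝔻⁰/K_N` is surjective): a sequence in `𝔻⁰` compatible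
modulo the congruence submodules has a limit in `𝔻⁰` congruent to each term. [cite: GreenbergStevens1993, §1] -/
theorem exists_limit_of_compatible {μs : ℕ → (n : ℕ) → T.Cell n → ℚ_[p]} (hμs : ∀ N, μs N ∈ T.distributionsInt p)
    (hcompat : ∀ N N' : ℕ, N ≤ N' → μs N' - μs N ∈ T.congrSub p N) :
    ∃ ν ∈ T.distributionsInt p, ∀ N, ν - μs N ∈ T.congrSub p N :=
  ⟨T.limitFn μs, T.limitFn_mem hμs hcompat, T.limitFn_sub_mem_congrSub hμs hcompat⟩

/-- **Uniqueness of the limit** (`⋂ K_N = 0`). [folklore] -/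
theorem limit_unique {μs : ℕ → (n : ℕ) → T.Cell n → ℚ_[p]} {ν ν' : (n : ℕ) → T.Cell n → ℚ_[p]}
    (hν : ∀ N, ν - μs N ∈ T.congrSub p N) (hν' : ∀ N, ν' - μs N ∈ T.congrSub p N) : ν = ν' := by
  have h : ν - ν' = 0 := T.eq_zero_of_forall_mem_congrSub fun N => by
    have := sub_mem (hν N) (hν' N)
    rwa [sub_sub_sub_cancel_right] at this
  exact sub_eq_zero.mp h

end ProfiniteTower

end Literature.NumberTheory.EllipticCurves

end
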